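import Literature.NumberTheory.GaloisCohomology.Howard2004.TowerCasselsTatePairingOfDefectsProofs
import Literature.NumberTheory.GaloisCohomology.Howard2004.TowerDualSlotCompatProofs
import HarnessLib

/-!
# Howard 2004, Prop. 1.4.1 — RIGHT-orthogonality of the class-level Cassels–Tate pairing `P` in `P`-currency:
# `P(a)(ι^D y′) = 0` for every dual-Selmer `y′` of level `t+1` — proofs file (brick «C451-CL RIGHT-P»)

Topic `NumberTheory/GaloisCohomology/Howard2004`. THEOREMS ONLY: no definition, no named fact, no instance, no notation,
no `sorry`.  Cell `pub/bsd-print-x9` (seat x10b-p1-w8 g12, LEAD g14's ask «→ w8: RIGHT-P» of 15:00:16Z;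
`--supports stmt-BirchSwinnertonDyer-22642`; print leaf G87 ↦ the «Flach leaf» C45.1′ / C45.1″).

The class-level pairing `P : H¹_{𝓕(n)}(K, T^{(i)}) × H¹_{𝓕(n)_0^*}(K, N_0^D) → ℤ/n₀` of x10b-p1-w2's
`TowerCasselsTatePairingOfDefectsProofs` is given through its VALUE CLAUSE `hP` («`P a y = ∑_{v ∈ Σ} inv_v(m_v ∪ loc_v y)` for every
lift / defect family / support»); this file plugs the Tate-dual-currency right-orthogonality of
`TowerSelmerLiftPairingRightOrthogonalProofs` (Q5-DUAL) and the dual-Selmer functoriality of `TowerSelmerTransposeDualSelmerProofs`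
into that clause.

SOURCE. B. Howard, *The Heegner point Kolyvagin system*, Compositio Math. **140** (2004) = arXiv:1202.6340, Prop. 1.4.1 (p0008
L83–98: «on the right the image of `π^s`»); A. Morgan, A. Smith, arXiv:2103.08530, §3; J. Milne, *Arithmetic Duality Theorems*,
Ch. I Thm. 4.10.

WHAT IS PROVED.  **`towerCasselsTatePairing_transpose_eq_zero`** — with the binders of `forall_towerCasselsTatePairing_eq_zero_iff`
(levels `i ≤ t+1`, `ι` with `hιg hιinj hιex hιF`, `inv` with reciprocity, `hlift`, `P` with `hP`) plus `n₀ T^{(t+1)} = 0`: for every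
`a ∈ H¹_{𝓕(n)}(K, T^{(i)})` and every `y′ ∈ H¹_{𝓕(n)_{t+1}^*}(K, T^{(t+1)*})`, `P a (H¹(ι^D) y′) = 0`, the element `H¹(ι^D) y′` of
`H¹_{𝓕(n)_0^*}(K, N_0^D)` being supplied by `cohomologyMap_transpose_mem_dualSelmerGroup_atLevel`; and the pointwise-membership
variant `towerCasselsTatePairing_eq_zero_of_eq_transpose` (`P a y = 0` whenever `↑y = H¹(ι^D) y′`), which is the form a caller with
its own membership proof uses; §2 **`towerCasselsTatePairing_eq_zero_of_eq_dualSlot_redLEH1`** — the `Ψ`-form: `P a y = 0`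
whenever `↑y = Ψ₀(H¹(red) z)` with `Ψ_{t+1} z` dual-Selmer of level `t+1` (slot compatibility `Ψ₀ ∘ H¹(red) = H¹(ι^D) ∘ Ψ_{t+1}` of
`TowerDualSlotCompatProofs`), i.e. `hright_le` of the tower entry read through Howard's `H¹_{𝓕*} ≅ H¹_𝓕`.

HONEST FRAMING: no new pairing is constructed; Prop. 1.4.1, C45.1′/C45.1″ and `thm161_dvrKolyvaginBound` are NOT proved; no summit
statement is proved; the Birch–Swinnerton-Dyer conjecture is not proved by any of this.
-/

set_option autoImplicit false

noncomputable section

namespace Literature.NumberTheory.GaloisCohomology.Howard2004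

open Function NumberField IsDedekindDomain Field CategoryTheory
open scoped NumberField ContRepresentation
open Literature.NumberTheory.GaloisRepresentations
open Literature.NumberTheory.GaloisRepresentations.DiscreteGaloisModule
open Literature.NumberTheory.GaloisCohomology (LocalInvariants)

namespace DVRSetting

variable {p : ℕ} [Fact p.Prime] {K : Type} [Field K] [NumberField K]
  {R : Type} [CommRing R] [IsDomain R] [IsDiscreteValuationRing R] [Algebra ℤ_[p] R]
  {N : ℕ → Type} [∀ k, AddCommGroup (N k)] [∀ k, TopologicalSpace (N k)]
  [∀ k, DiscreteTopology (N k)] [∀ k, Module R (N k)]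
  {Rk : ℕ → Type} [∀ k, CommRing (Rk k)] [∀ k, IsLocalRing (Rk k)] [∀ k, TopologicalSpace (Rk k)]
  [∀ k, DiscreteTopology (Rk k)] [∀ k, Algebra ℤ_[p] (Rk k)] [∀ k, Algebra R (Rk k)]
  [∀ k, Module (Rk k) (N k)] [∀ k, IsScalarTower R (Rk k) (N k)]
  {Nbar : Type} [AddCommGroup Nbar] [TopologicalSpace Nbar] [DiscreteTopology Nbar]
  [∀ k, Module (Rk k) Nbar]
  {Nq : ℕ → Finset (HeightOneSpectrum (𝓞 K)) → Type} [∀ k n, AddCommGroup (Nq k n)]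
  [∀ k n, TopologicalSpace (Nq k n)] [∀ k n, DiscreteTopology (Nq k n)]
  [∀ k n, Module (Rk k) (Nq k n)] [∀ k n, Module R (Nq k n)]
  [∀ k n, IsScalarTower R (Rk k) (Nq k n)]

section RightP

variable [∀ k, Finite (N k)] (S : DVRSetting p K R N Rk Nbar Nq) (hy : S.SatisfiesH)
  (hu : ¬ p ∣ Nat.card (𝓞 K)ˣ) {i t : ℕ} (hit : i ≤ t + 1) {n : Finset (HeightOneSpectrum (𝓞 K))}
  (hn : ↑n ⊆ S.levelPrimes (t + 1)) (ι : N 0 →ₗ[R] N (t + 1))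
  (hιg : ∀ (g : absoluteGaloisGroup K) (x : N 0), ι (S.T.ρ 0 g x) = S.T.ρ (t + 1) g (ι x))
  (hιinj : Function.Injective ι) (hιex : ∀ y : N (t + 1), S.T.redLE hit y = 0 ↔ ∃ x, ι x = y)
  {n₀ : ℕ} [NeZero n₀] (hM₁ : ∀ x : N (t + 1), n₀ • x = 0) (inv : LocalInvariants K n₀) (hPT : inv.SumLocalTermEqZero)
  (hlift : ∀ a ∈ (((S.t i).atLevel S.jbar n).cond).selmerGroup,
    ∃ ã : galoisCohomology (S.T.ρ (t + 1)) 1, S.redLEH1 hit ã = a)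
  (P : ↥(((S.t i).atLevel S.jbar n).cond).selmerGroup →+
      ↥(inv.dualSelmerStructure (S.T.ρ 0) ((S.t 0).atLevel S.jbar n).cond).selmerGroup →+ ZMod n₀)
  (hP : ∀ (a : ↥(((S.t i).atLevel S.jbar n).cond).selmerGroup) (ã : galoisCohomology (S.T.ρ (t + 1)) 1)
      (_ : S.redLEH1 hit ã = a) (m : ∀ v : Place K, galoisCohomology ((S.T.ρ 0).toLocal v) 1)
      (_ : ∀ v, ∃ ℓ ∈ ((S.t (t + 1)).atLevel S.jbar n).cond v,
        galoisCohomology.localization (S.T.ρ (t + 1)) v 1 ã - ℓ =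
          ContinuousRep.cohomologyMap ((S.T.ρ 0).toLocal v) ((S.T.ρ (t + 1)).toLocal v) ι.toAddMonoidHom
            continuous_of_discreteTopology (fun _ x => hιg _ x) 1 (m v))
      (Sfin : Finset (Place K)) (_ : ∀ v ∉ Sfin, m v = 0)
      (y : ↥(inv.dualSelmerStructure (S.T.ρ 0) ((S.t 0).atLevel S.jbar n).cond).selmerGroup),
      P a y = ∑ v ∈ Sfin, localTatePairingZMod (S.T.ρ 0) n₀ v (inv v) (m v)
        (galoisCohomology.localization ((S.T.ρ 0).tateDual n₀) v 1 y))

include hy hu hn hιinj hιex hM₁ hPT hlift hP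

/-- **`P a y = 0` whenever `y` IS `H¹(ι^D) y′` for a dual-Selmer `y′` of level `t+1`** (value clause `hP` on the canonical lift and
defects of `a`, then `sum_localTatePairingZMod_defects_transpose_eq_zero`).  The membership of `y` is the caller's.
[cite: Howard2004HeegnerKolyvagin, Prop. 1.4.1 (arXiv:1202.6340 p0008 L83–98)] [cite: MilneADT2006, Ch. I, Thm. 4.10] -/
theorem towerCasselsTatePairing_eq_zero_of_eq_transpose (a : ↥(((S.t i).atLevel S.jbar n).cond).selmerGroup)
    (y : ↥(inv.dualSelmerStructure (S.T.ρ 0) ((S.t 0).atLevel S.jbar n).cond).selmerGroup)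
    {y' : galoisCohomology ((S.T.ρ (t + 1)).tateDual n₀) 1}
    (hy' : y' ∈ (inv.dualSelmerStructure (S.T.ρ (t + 1)) ((S.t (t + 1)).atLevel S.jbar n).cond).selmerGroup)
    (hyy' : (y : galoisCohomology ((S.T.ρ 0).tateDual n₀) 1) =
      ContinuousRep.cohomologyMap ((S.T.ρ (t + 1)).tateDual n₀) ((S.T.ρ 0).tateDual n₀)
        (pairingDualHom n₀ ((tateDualEval K (N (t + 1)) n₀).comp ι.toAddMonoidHom)) continuous_of_discreteTopology
        (pairingDualHom_smul (S.pairing_transpose_smul n₀ ι hιg)) 1 y') :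
    P a y = 0 := by
  obtain ⟨ã, hã⟩ := hlift a.1 a.2
  obtain ⟨Sfin, m, hm, hmS⟩ := S.exists_localDefects_of_redLEH1_mem hy hu hit hn ι hιg hιinj hιex ã (hã ▸ a.2)
  rw [hP a ã hã m hm Sfin hmS y, hyy']
  exact S.sum_localTatePairingZMod_defects_transpose_eq_zero n ι hιg hM₁ inv hPT Sfin ã m hm hmS hy'

/-- **RIGHT-P: `P(a)(H¹(ι^D) y′) = 0`** for every `a ∈ H¹_{𝓕(n)}(K, T^{(i)})` and every `y′ ∈ H¹_{𝓕(n)_{t+1}^*}(K, T^{(t+1)*})`, the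
element `H¹(ι^D) y′ ∈ H¹_{𝓕(n)_0^*}(K, N_0^D)` being `cohomologyMap_transpose_mem_dualSelmerGroup_atLevel` (needs only the direction
`m ∈ 𝓕(n)_{0,v} ⟹ H¹_v(ι) m ∈ 𝓕(n)_{t+1,v}` of `hιF`).  Howard: «on the right the image of `π^s H¹_{𝓕*}(K, T*[𝔪^{s+1}])`» pairs
to zero. [cite: Howard2004HeegnerKolyvagin, Prop. 1.4.1 (arXiv:1202.6340 p0008 L83–98)] [cite: MilneADT2006, Ch. I, Thm. 4.10] -/
theorem towerCasselsTatePairing_transpose_eq_zero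
    (hιF : ∀ (v : Place K) (m : galoisCohomology ((S.T.ρ 0).toLocal v) 1),
      ContinuousRep.cohomologyMap ((S.T.ρ 0).toLocal v) ((S.T.ρ (t + 1)).toLocal v) ι.toAddMonoidHom
          continuous_of_discreteTopology (fun _ x => hιg _ x) 1 m ∈ ((S.t (t + 1)).atLevel S.jbar n).cond v ↔
        m ∈ ((S.t 0).atLevel S.jbar n).cond v)
    (a : ↥(((S.t i).atLevel S.jbar n).cond).selmerGroup)
    {y' : galoisCohomology ((S.T.ρ (t + 1)).tateDual n₀) 1}
    (hy' : y' ∈ (inv.dualSelmerStructure (S.T.ρ (t + 1)) ((S.t (t + 1)).atLevel S.jbar n).cond).selmerGroup) :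
    P a ⟨ContinuousRep.cohomologyMap ((S.T.ρ (t + 1)).tateDual n₀) ((S.T.ρ 0).tateDual n₀)
        (pairingDualHom n₀ ((tateDualEval K (N (t + 1)) n₀).comp ι.toAddMonoidHom)) continuous_of_discreteTopology
        (pairingDualHom_smul (S.pairing_transpose_smul n₀ ι hιg)) 1 y',
      S.cohomologyMap_transpose_mem_dualSelmerGroup_atLevel n ι hιg inv (fun v m hm => (hιF v m).2 hm) hy'⟩ = 0 :=
  S.towerCasselsTatePairing_eq_zero_of_eq_transpose hy hu hit hn ι hιg hιinj hιex hM₁ inv hPT hlift P hP a _ hy' rfl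

end RightP

/-! ## §2 The `Ψ`-form: `P(a)(Ψ₀(red z)) = 0` -/

/-- **`P a y = 0` whenever `y` IS `Ψ₀(H¹(red) z)` with `Ψ_{t+1} z ∈ H¹_{𝓕(n)_{t+1}^*}(K, T^{(t+1)*})`** (level `n₀ = p^{k′}`) — for the
slots `Ψ₀`, `Ψ_{t+1}` (cocycle clauses of `exists_conjTransfer` for `Θ₀ = (S.D 0).toTateDual λ₀ …`, `Θ_{t+1} = (S.D (t+1)).toTateDual λ₁ …`)
of a compatible pair `(λ₀, λ₁)` (`hcompat`) and `ι ∘ red = π^d` (`hι`): by `Ψ₀ ∘ H¹(red) = H¹(ι^D) ∘ Ψ_{t+1}`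
(`dualSlot_redLEH1_eq_cohomologyMap_transpose_iota`) and §1.  With `z ∈ 𝓗_{t+1}(n)` (so `Ψ_{t+1} z` is dual-Selmer by the
level-`t+1` slot) this is the clause `hright_le` of the tower entry, read through Howard's `H¹_{𝓕*} ≅ H¹_𝓕`.
[cite: Howard2004HeegnerKolyvagin, Prop. 1.4.1 and Thm. 1.4.2 proof (arXiv:1202.6340 p0008 L83–124)] [cite: MilneADT2006, Ch. I, Thm. 4.10] -/
theorem towerCasselsTatePairing_eq_zero_of_eq_dualSlot_redLEH1 [∀ k, Finite (N k)] (S : DVRSetting p K R N Rk Nbar Nq)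
    (hy : S.SatisfiesH) (hu : ¬ p ∣ Nat.card (𝓞 K)ˣ) {i t : ℕ} (hit : i ≤ t + 1) {n : Finset (HeightOneSpectrum (𝓞 K))}
    (hn : ↑n ⊆ S.levelPrimes (t + 1)) (ι : N 0 →ₗ[R] N (t + 1))
    (hιg : ∀ (g : absoluteGaloisGroup K) (x : N 0), ι (S.T.ρ 0 g x) = S.T.ρ (t + 1) g (ι x))
    (hιinj : Function.Injective ι) (hιex : ∀ y : N (t + 1), S.T.redLE hit y = 0 ↔ ∃ x, ι x = y)
    (hι : ∀ y : N (t + 1), ι (S.T.redLE (Nat.zero_le (t + 1)) y) = S.π ^ (S.e (t + 1) - S.e 0) • y)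
    {k' : ℕ} [NeZero (p ^ k')] (hM₁ : ∀ x : N (t + 1), (p ^ k') • x = 0) (inv : LocalInvariants K (p ^ k'))
    (hPT : inv.SumLocalTermEqZero)
    (hlift : ∀ a ∈ (((S.t i).atLevel S.jbar n).cond).selmerGroup,
      ∃ ã : galoisCohomology (S.T.ρ (t + 1)) 1, S.redLEH1 hit ã = a)
    (P : ↥(((S.t i).atLevel S.jbar n).cond).selmerGroup →+
        ↥(inv.dualSelmerStructure (S.T.ρ 0) ((S.t 0).atLevel S.jbar n).cond).selmerGroup →+ ZMod (p ^ k'))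
    (hP : ∀ (a : ↥(((S.t i).atLevel S.jbar n).cond).selmerGroup) (ã : galoisCohomology (S.T.ρ (t + 1)) 1)
        (_ : S.redLEH1 hit ã = a) (m : ∀ v : Place K, galoisCohomology ((S.T.ρ 0).toLocal v) 1)
        (_ : ∀ v, ∃ ℓ ∈ ((S.t (t + 1)).atLevel S.jbar n).cond v,
          galoisCohomology.localization (S.T.ρ (t + 1)) v 1 ã - ℓ =
            ContinuousRep.cohomologyMap ((S.T.ρ 0).toLocal v) ((S.T.ρ (t + 1)).toLocal v) ι.toAddMonoidHom
              continuous_of_discreteTopology (fun _ x => hιg _ x) 1 (m v))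
        (Sfin : Finset (Place K)) (_ : ∀ v ∉ Sfin, m v = 0)
        (y : ↥(inv.dualSelmerStructure (S.T.ρ 0) ((S.t 0).atLevel S.jbar n).cond).selmerGroup),
        P a y = ∑ v ∈ Sfin, localTatePairingZMod (S.T.ρ 0) (p ^ k') v (inv v) (m v)
          (galoisCohomology.localization ((S.T.ρ 0).tateDual (p ^ k')) v 1 y))
    (lam₀ : Rk 0 →+ ZMod (p ^ k')) (lam₁ : Rk (t + 1) →+ ZMod (p ^ k'))
    (hlam₀ : ∀ (z : ℤ_[p]) (r : Rk 0), lam₀ (algebraMap ℤ_[p] (Rk 0) z * r) = PadicInt.toZModPow k' z * lam₀ r)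
    (hlam₁ : ∀ (z : ℤ_[p]) (r : Rk (t + 1)), lam₁ (algebraMap ℤ_[p] (Rk (t + 1)) z * r) = PadicInt.toZModPow k' z * lam₁ r)
    (exp : ZMod (p ^ k') →+ MuCarrier K (p ^ k'))
    (hexp : ∀ (g : absoluteGaloisGroup K) (x : ZMod (p ^ k')),
      exp (cyclotomicCharacterModPow K p k' g * x) = mu K (p ^ k') g (exp x))
    (hcompat : ∀ r : R, lam₁ (algebraMap R (Rk (t + 1)) (S.π ^ (S.e (t + 1) - S.e 0) * r)) = lam₀ (algebraMap R (Rk 0) r))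
    (Ψ₀ : galoisCohomology (S.T.ρ 0) 1 →+ galoisCohomology ((S.T.ρ 0).tateDual (p ^ k')) 1)
    (hΨ₀ : ∀ (φ : contOneCocycles (S.T.ρ 0).toTopRep) (ψ : contOneCocycles ((S.T.ρ 0).tateDual (p ^ k')).toTopRep),
      (∀ g, ψ.1 g = ((S.D 0).toTateDual lam₀ hlam₀ exp hexp).toContinuousLinearMap.toLinearMap.toAddMonoidHom
        (φ.1 (S.cd.conj g))) → Ψ₀ (oneCocycleClass _ φ) = oneCocycleClass _ ψ)
    (Ψ₁ : galoisCohomology (S.T.ρ (t + 1)) 1 →+ galoisCohomology ((S.T.ρ (t + 1)).tateDual (p ^ k')) 1)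
    (hΨ₁ : ∀ (φ : contOneCocycles (S.T.ρ (t + 1)).toTopRep)
      (ψ : contOneCocycles ((S.T.ρ (t + 1)).tateDual (p ^ k')).toTopRep),
      (∀ g, ψ.1 g = ((S.D (t + 1)).toTateDual lam₁ hlam₁ exp hexp).toContinuousLinearMap.toLinearMap.toAddMonoidHom
        (φ.1 (S.cd.conj g))) → Ψ₁ (oneCocycleClass _ φ) = oneCocycleClass _ ψ)
    (a : ↥(((S.t i).atLevel S.jbar n).cond).selmerGroup)
    (y : ↥(inv.dualSelmerStructure (S.T.ρ 0) ((S.t 0).atLevel S.jbar n).cond).selmerGroup)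
    (z : galoisCohomology (S.T.ρ (t + 1)) 1)
    (hΨz : Ψ₁ z ∈ (inv.dualSelmerStructure (S.T.ρ (t + 1)) ((S.t (t + 1)).atLevel S.jbar n).cond).selmerGroup)
    (hyz : (y : galoisCohomology ((S.T.ρ 0).tateDual (p ^ k')) 1) = Ψ₀ (S.redLEH1 (Nat.zero_le (t + 1)) z)) :
    P a y = 0 :=
  S.towerCasselsTatePairing_eq_zero_of_eq_transpose hy hu hit hn ι hιg hιinj hιex hM₁ inv hPT hlift P hP a y hΨz
    (hyz.trans (S.dualSlot_redLEH1_eq_cohomologyMap_transpose_iota hy ι hι hιg lam₀ lam₁ hlam₀ hlam₁ exp hexp hcompat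
      Ψ₀ hΨ₀ Ψ₁ hΨ₁ z))


end DVRSetting

end Literature.NumberTheory.GaloisCohomology.Howard2004

end
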